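import Summits.ABC.IUTFork.Joshi.ThetaJoshiAdelicBL
import Summits.ABC.IUTFork.Joshi.StandardPointNormsSupply
import Summits.ABC.IUTFork.Joshi.FundamentalEstimateBLFixedRho
import HarnessLib

/-!
# [J-III] Thm. 7.3.1 AS TYPED ON THE ACTUAL LOCUS `Θ̃^{B_{L′}}_Joshi` (Def. 6.10.2), from the one-prime prototypes
# ([J-IIp] Thm. 6.9.1 + §5.1) and the ONE located input (STD) — the §3 merge-debt «E-t8/E-t10 ↔ E-t12» closed in kernel

Proof-only companion (abc-iut cell, block E «type Joshi's construction, test vs S», rung LADDER-ABC:A2.E; seat abc-iut-E-t12,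
gen 2; ASSIGNMENTS §4 FALLBACK #4 «merge-debt reconciliation once the carrier you stubbed has landed» and the END-GAME BOOK
09:05:34Z «companions on BUILT files») of
* `Joshi/FundamentalEstimateBL*.lean` (abc-iut-E-t12, slot T-12: [J-III] §7.1–7.4 over the interim signature `ATS3.AdelicThetaDatum`;
  hypothesis `StandardPointNorms` = the printed norm values at the standard point, proof of Thm. 7.3.1 p.56 l.22–45),
* `Joshi/ThetaJoshiAdelicBL.lean` (abc-iut-E-t11, p431766: the signature RE-KEYED from the typed §6 objects — the re-keyed locus IS
  `Θ̃^{B_{L′}}_Joshi` of Def. 6.10.2, `locus_toAdelicThetaDatum`; `standardPointNorms_iff_absK`; `fundamentalEstimateBL_of_absK`),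
* `Joshi/StandardPointNormsSupply.lean` (abc-iut-E-t8, p431046, slot T-55: the residue-field values DERIVED from abc-iut-E-t3's one-prime
  `PrototypeDatum` — [J-IIp] Thm. 6.9.1 `scale_ansatzPt`, §5.1 `abs0_xi` — under the glue (G1)–(G3), (ANS) and the located (STD)).
Until now the last two did not meet: E-t8's `AdelicThetaDatum.fundamentalEstimateBL_of_prototype` concludes for an ABSTRACT datum read
through abc-iut-E-t10's lift data, E-t11's `AdelicLiftDatum.fundamentalEstimateBL_of_absK` starts from the residue-field values. THIS FILE
composes them (kernel glue only, 0 new definitions): for every `BLData X` of an `AdelicLiftDatum 𝔇` and one-prime prototypes `P w`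
on the same point types `|Y_{ℂ♭_{p_w},L′_w}|` at the places `w ∈ V^{odd,ss}`, glued by
(G1) `hl` «the same `ℓ⋇`» ([J-III] §3.3 (11)); (G2) `hq0` «`|q|_0 = |q_w|_{ℂ_{p_w}}`» (Thm. 7.3.1's normalisation, p.55 l.3–9); (G3) `hxi` «the theta
value `ξ_1` computed in `K_{y′_{w,j}}` has the same absolute value in both carriers» (p.56 l.29–37); (ANS) `ha`/`hy` «the `w`-component of `z_Θ` is a
point of Mochizuki's primitive Ansatz» ([J-III] Def. 4.2.2 / (4.2.1.4) p.31–32; [J-IIp] Def. 6.2.3); and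
(STD) `hstd` — THE LOCATED INPUT — «the residue field at the LAST coordinate `y_{ℓ⋇} = y′_0` of `z_Θ` is `ℂ_p` WITH ITS STANDARD VALUATION
(`scale = 1`)» ([J-III] §4.5 p.36 l.11–17 + §4.4 p.35 l.87–97; [J-IIp] p.27 l.8–12; a Fargues–Fontaine fact, [FF18] Thm. 6.5.2 / §10.1, that no
block-E carrier constructs),
one gets, ON THE ACTUAL LOCUS: the residue-field values `|ξ_{1;K_{y′_{w,j}}}| = |q_w|^{(1/2ℓ)(j²/ℓ⋇²)}` at the components of `z_Θ`
(`absK_zTheta_of_prototype`), hence `StandardPointNorms` (`standardPointNorms_of_prototype`), hence **Thm. 7.3.1 AS TYPED**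
(`FundamentalEstimateBL`, `fundamentalEstimateBL_of_prototype`, every `ℓ ≥ 5`), its fixed-`ρ` form and the repaired Cor. 7.4.1 at
fixed `0 < ρ < 1` (`fundamentalEstimateBLAt_of_prototype`, `cor741At_of_prototype`; E-t12 p432151), and the closed product form of the size
of the distinguished element `Ξ^α_{0,z_Θ}` (p.56 l.38–45; `adelicSize_distinguishedLift_of_prototype`).
HONEST SCOPE: a conditional kernel statement about a typed CANDIDATE; its inputs are carrier glue + one located print sentence; no claim of
Joshi's is asserted; no FACT-LIST row consumed; no new `Prop`. Sources: K. Joshi, arXiv:2401.13508v4 = [J-III] (unrefereed; bib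
`Joshi2024ATS3`), arXiv:2303.01662v3 = [J-IIp] (bib `Joshi2023ATS2Local`). TAKES NO SIDE on [IUTchIII] Cor. 3.12, on Joshi's claims or on
Mochizuki's report on them; typed ≠ proved ≠ endorsed. Object-side file (E-PLAN R14: imports Joshi object files only).
-/

noncomputable section

namespace Summit.ABC.IUTFork.Joshi.ATS3

namespace AdelicLiftDatum

variable {A : CollationDatum} {OE B : A.V → Type} [∀ w, CommRing (OE w)] [∀ w, CommRing (B w)]
  [∀ w, Algebra (OE w) (B w)] (𝔇 : AdelicLiftDatum A OE B)

/-! ## 0. Bookkeeping on the re-keyed datum -/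

/-- The re-keyed datum's `ℓ⋇` is the collation datum's `ℓ⋇`. [folklore] -/
theorem lstar_toAdelicThetaDatum (X : 𝔇.BLData) : (𝔇.toAdelicThetaDatum X).lstar = A.lstar := rfl

/-- The re-keyed datum's `ℓ = 2ℓ⋇ + 1`. [folklore] -/
theorem ell_toAdelicThetaDatum (X : 𝔇.BLData) : (𝔇.toAdelicThetaDatum X).ell = 2 * A.lstar + 1 := rfl

/-- The exponent `(1/2ℓ)·(j²/ℓ⋇²)` of `StandardPointNorms` on the re-keyed datum, spelled out. [folklore] -/
theorem stdExponent_toAdelicThetaDatum (X : 𝔇.BLData) (j : Fin A.lstar) :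
    (𝔇.toAdelicThetaDatum X).stdExponent j =
      (1 / (2 * ((2 * A.lstar + 1 : ℕ) : ℝ))) * ((((j : ℕ) : ℝ) + 1) ^ 2 / ((A.lstar : ℝ) ^ 2)) := rfl

/-! ## 1. The residue-field values at the standard point from the one-prime prototypes -/

section Prototype

variable {F B₀ E₀ : A.V → Type} [∀ w, Field (F w)] [∀ w, CommRing (B₀ w)] [∀ w, Field (E₀ w)]
  {K : ∀ w, A.Y w → Type} [∀ w (y : A.Y w), Field (K w y)] {G : A.V → Type}

/-- **The residue-field values at the components of `z_Θ`, DERIVED from the prototypes** (modulo (STD)): for `w ∈ V^{odd,ss}` and every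
label `j`, `|ξ_{1;K_{y′_{w,j}}}|_{K_{y′_{w,j}}} = |q_w|_{ℂ_{p_w}}^{(1/2ℓ)·(j²/ℓ⋇²)}` — [J-IIp] (9.2.3) (`PrototypeDatum.absK_xi_ansatzPt_of_std`, from Thm. 6.9.1)
and §5.1 (`abs0_xi`) transported along (G1)–(G3), (ANS). This is exactly the right side of E-t11's `standardPointNorms_iff_absK`.
[claim: Joshi2024ATS3, status: disputed] -/
theorem absK_zTheta_of_prototype (X : 𝔇.BLData)
    (P : ∀ w, PrototypeDatum (F w) (B₀ w) (E₀ w) (A.Y w) (K w) (G w))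
    (hl : ∀ w ∈ A.Voddss, (P w).lstar = A.lstar)
    (hq0 : ∀ w ∈ A.Voddss, (P w).abs0 (P w).q = X.qAbs w)
    (hxi : ∀ w ∈ A.Voddss, ∀ j : Fin A.lstar,
      (𝔇.lift w).absK (A.wComponent X.zTheta w j) ((𝔇.lift w).xi (A.wComponent X.zTheta w j)) =
        (P w).absK (A.wComponent X.zTheta w j) ((P w).emb (A.wComponent X.zTheta w j) (P w).xi))
    (a : ∀ w, F w) (ha : ∀ w ∈ A.Voddss, a w ∈ (P w).AnsatzParam)
    (hy : ∀ w (hw : w ∈ A.Voddss) (j : Fin A.lstar),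
      A.wComponent X.zTheta w j = (P w).ansatzPt (a w) (Fin.cast (hl w hw).symm j))
    (hstd : ∀ w (hw : w ∈ A.Voddss), (P w).scale (A.wComponent X.zTheta w (𝔇.toAdelicThetaDatum X).lastLabel) = 1) :
    ∀ w ∈ A.Voddss, ∀ j : Fin A.lstar,
      (𝔇.lift w).absK (A.wComponent X.zTheta w j) ((𝔇.lift w).xi (A.wComponent X.zTheta w j)) =
        X.qAbs w ^ (𝔇.toAdelicThetaDatum X).stdExponent j := by
  intro w hw j
  -- bookkeeping: the cast of the last label is the prototype's last index
  have hlast : Fin.cast (hl w hw).symm (𝔇.toAdelicThetaDatum X).lastLabel = (P w).lastIdx := by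
    apply Fin.ext
    simp only [Fin.val_cast, AdelicThetaDatum.lastLabel, PrototypeDatum.lastIdx, hl w hw]
    rfl
  -- (STD) transported to the prototype's last Ansatz point
  have hstdP : (P w).scale ((P w).ansatzPt (a w) (P w).lastIdx) = 1 := by
    rw [← hlast, ← hy w hw]
    exact hstd w hw
  rw [stdExponent_toAdelicThetaDatum, hxi w hw j, hy w hw j, (P w).absK_xi_ansatzPt_of_std (ha w hw) hstdP, (P w).abs0_xi,
    ← Real.rpow_mul (P w).abs0_q.1.le, hq0 w hw]
  congr 1
  simp only [Fin.val_cast, hl w hw]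

/-- **`StandardPointNorms` ON THE ACTUAL LOCUS** (the printed norm values at `Ξ^α_{0,z_Θ}`, proof of Thm. 7.3.1 p.56 l.22–45), from the
prototypes modulo (STD): E-t11's `standardPointNorms_iff_absK` applied to `absK_zTheta_of_prototype`. [claim: Joshi2024ATS3, status: disputed] -/
theorem standardPointNorms_of_prototype (X : 𝔇.BLData)
    (P : ∀ w, PrototypeDatum (F w) (B₀ w) (E₀ w) (A.Y w) (K w) (G w))
    (hl : ∀ w ∈ A.Voddss, (P w).lstar = A.lstar)
    (hq0 : ∀ w ∈ A.Voddss, (P w).abs0 (P w).q = X.qAbs w)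
    (hxi : ∀ w ∈ A.Voddss, ∀ j : Fin A.lstar,
      (𝔇.lift w).absK (A.wComponent X.zTheta w j) ((𝔇.lift w).xi (A.wComponent X.zTheta w j)) =
        (P w).absK (A.wComponent X.zTheta w j) ((P w).emb (A.wComponent X.zTheta w j) (P w).xi))
    (a : ∀ w, F w) (ha : ∀ w ∈ A.Voddss, a w ∈ (P w).AnsatzParam)
    (hy : ∀ w (hw : w ∈ A.Voddss) (j : Fin A.lstar),
      A.wComponent X.zTheta w j = (P w).ansatzPt (a w) (Fin.cast (hl w hw).symm j))
    (hstd : ∀ w (hw : w ∈ A.Voddss), (P w).scale (A.wComponent X.zTheta w (𝔇.toAdelicThetaDatum X).lastLabel) = 1) :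
    (𝔇.toAdelicThetaDatum X).StandardPointNorms :=
  (𝔇.standardPointNorms_iff_absK X).2 (𝔇.absK_zTheta_of_prototype X P hl hq0 hxi a ha hy hstd)

/-! ## 2. Thm. 7.3.1 and its corollaries ON THE ACTUAL LOCUS -/

/-- **[J-III] Thm. 7.3.1 AS TYPED, ON THE ACTUAL LOCUS `Θ̃^{B_{L′}}_Joshi` of Def. 6.10.2** (`locus_toAdelicThetaDatum`), for every `ℓ ≥ 5`:
`∏_{w ∈ V^{odd,ss}} |q_w|^{ℓ⋇/2ℓ} ≤ |Θ̃^{B_{L′}}_Joshi|_{B_{L′}}`, from the one-prime prototypes ([J-IIp] Thm. 6.9.1 + §5.1 as kernel theorems of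
the carrier) under (G1)–(G3), (ANS) and the located (STD). Composition of E-t11's `fundamentalEstimateBL_of_absK` with §1. A conditional
kernel statement about a typed candidate; nothing is asserted about its inputs. [claim: Joshi2024ATS3, status: disputed] -/
theorem fundamentalEstimateBL_of_prototype (X : 𝔇.BLData)
    (P : ∀ w, PrototypeDatum (F w) (B₀ w) (E₀ w) (A.Y w) (K w) (G w))
    (hl : ∀ w ∈ A.Voddss, (P w).lstar = A.lstar)
    (hq0 : ∀ w ∈ A.Voddss, (P w).abs0 (P w).q = X.qAbs w)
    (hxi : ∀ w ∈ A.Voddss, ∀ j : Fin A.lstar,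
      (𝔇.lift w).absK (A.wComponent X.zTheta w j) ((𝔇.lift w).xi (A.wComponent X.zTheta w j)) =
        (P w).absK (A.wComponent X.zTheta w j) ((P w).emb (A.wComponent X.zTheta w j) (P w).xi))
    (a : ∀ w, F w) (ha : ∀ w ∈ A.Voddss, a w ∈ (P w).AnsatzParam)
    (hy : ∀ w (hw : w ∈ A.Voddss) (j : Fin A.lstar),
      A.wComponent X.zTheta w j = (P w).ansatzPt (a w) (Fin.cast (hl w hw).symm j))
    (hstd : ∀ w (hw : w ∈ A.Voddss), (P w).scale (A.wComponent X.zTheta w (𝔇.toAdelicThetaDatum X).lastLabel) = 1) :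
    (𝔇.toAdelicThetaDatum X).FundamentalEstimateBL :=
  𝔇.fundamentalEstimateBL_of_absK X (𝔇.absK_zTheta_of_prototype X P hl hq0 hxi a ha hy hstd)

/-- **The local step (7.3.3)/(7.3.4) at EVERY `ρ ∈ (0,1]` ON THE ACTUAL LOCUS** (`LocalThetaEstimate`: at each `w ∈ V^{odd,ss}` the `(B_{L′_w},ρ)`-size
of the `w`-component of `Ξ^α_{0,z_Θ}` is `≥ |q_w|^{ℓ⋇/2ℓ}`, strictly `>`), from the prototypes modulo (STD). [claim: Joshi2024ATS3, status: disputed] -/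
theorem localThetaEstimate_of_prototype (X : 𝔇.BLData)
    (P : ∀ w, PrototypeDatum (F w) (B₀ w) (E₀ w) (A.Y w) (K w) (G w))
    (hl : ∀ w ∈ A.Voddss, (P w).lstar = A.lstar)
    (hq0 : ∀ w ∈ A.Voddss, (P w).abs0 (P w).q = X.qAbs w)
    (hxi : ∀ w ∈ A.Voddss, ∀ j : Fin A.lstar,
      (𝔇.lift w).absK (A.wComponent X.zTheta w j) ((𝔇.lift w).xi (A.wComponent X.zTheta w j)) =
        (P w).absK (A.wComponent X.zTheta w j) ((P w).emb (A.wComponent X.zTheta w j) (P w).xi))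
    (a : ∀ w, F w) (ha : ∀ w ∈ A.Voddss, a w ∈ (P w).AnsatzParam)
    (hy : ∀ w (hw : w ∈ A.Voddss) (j : Fin A.lstar),
      A.wComponent X.zTheta w j = (P w).ansatzPt (a w) (Fin.cast (hl w hw).symm j))
    (hstd : ∀ w (hw : w ∈ A.Voddss), (P w).scale (A.wComponent X.zTheta w (𝔇.toAdelicThetaDatum X).lastLabel) = 1) :
    (𝔇.toAdelicThetaDatum X).LocalThetaEstimate :=
  (𝔇.toAdelicThetaDatum X).localThetaEstimate_of_standardPointNorms
    (𝔇.standardPointNorms_of_prototype X P hl hq0 hxi a ha hy hstd)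

/-- **Thm. 7.3.1 AT FIXED `ρ ∈ (0,1]` ON THE ACTUAL LOCUS** (E-t12's repaired reading `FundamentalEstimateBLAt ρ`, p432151: what the printed proof
p.56 l.62–109 establishes before the supremum over `ρ` of Def. 7.2.7), from the prototypes modulo (STD). [claim: Joshi2024ATS3, status: disputed] -/
theorem fundamentalEstimateBLAt_of_prototype (X : 𝔇.BLData)
    (P : ∀ w, PrototypeDatum (F w) (B₀ w) (E₀ w) (A.Y w) (K w) (G w))
    (hl : ∀ w ∈ A.Voddss, (P w).lstar = A.lstar)
    (hq0 : ∀ w ∈ A.Voddss, (P w).abs0 (P w).q = X.qAbs w)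
    (hxi : ∀ w ∈ A.Voddss, ∀ j : Fin A.lstar,
      (𝔇.lift w).absK (A.wComponent X.zTheta w j) ((𝔇.lift w).xi (A.wComponent X.zTheta w j)) =
        (P w).absK (A.wComponent X.zTheta w j) ((P w).emb (A.wComponent X.zTheta w j) (P w).xi))
    (a : ∀ w, F w) (ha : ∀ w ∈ A.Voddss, a w ∈ (P w).AnsatzParam)
    (hy : ∀ w (hw : w ∈ A.Voddss) (j : Fin A.lstar),
      A.wComponent X.zTheta w j = (P w).ansatzPt (a w) (Fin.cast (hl w hw).symm j))
    (hstd : ∀ w (hw : w ∈ A.Voddss), (P w).scale (A.wComponent X.zTheta w (𝔇.toAdelicThetaDatum X).lastLabel) = 1)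
    {ρ : ℝ} (hρ : ρ ∈ Set.Ioc (0 : ℝ) 1) :
    (𝔇.toAdelicThetaDatum X).FundamentalEstimateBLAt ρ :=
  (𝔇.toAdelicThetaDatum X).fundamentalEstimateBLAt_of_standardPointNorms
    (𝔇.standardPointNorms_of_prototype X P hl hq0 hxi a ha hy hstd) hρ

/-- **The repaired Cor. 7.4.1 at fixed `0 < ρ < 1` ON THE ACTUAL LOCUS** (E-t12's `Cor741At ρ`, p432151: for every special precompact `Φ`,
`∏_w |q_w|^{ℓ⋇/2ℓ} < |Φ|_{B_{L′},ρ} < ∞`), from the prototypes modulo (STD), as soon as `V^{odd,ss}` is non-empty (strictness needs one bad place;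
[J-III] §3.4). The PRINTED Cor. 7.4.1 (supremum over all `ρ`) is refuted at interface level by E-t12's `not_cor741_flatDatum` (p430788) and is NOT
claimed here. [claim: Joshi2024ATS3, status: disputed] -/
theorem cor741At_of_prototype (X : 𝔇.BLData)
    (P : ∀ w, PrototypeDatum (F w) (B₀ w) (E₀ w) (A.Y w) (K w) (G w))
    (hl : ∀ w ∈ A.Voddss, (P w).lstar = A.lstar)
    (hq0 : ∀ w ∈ A.Voddss, (P w).abs0 (P w).q = X.qAbs w)
    (hxi : ∀ w ∈ A.Voddss, ∀ j : Fin A.lstar,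
      (𝔇.lift w).absK (A.wComponent X.zTheta w j) ((𝔇.lift w).xi (A.wComponent X.zTheta w j)) =
        (P w).absK (A.wComponent X.zTheta w j) ((P w).emb (A.wComponent X.zTheta w j) (P w).xi))
    (a : ∀ w, F w) (ha : ∀ w ∈ A.Voddss, a w ∈ (P w).AnsatzParam)
    (hy : ∀ w (hw : w ∈ A.Voddss) (j : Fin A.lstar),
      A.wComponent X.zTheta w j = (P w).ansatzPt (a w) (Fin.cast (hl w hw).symm j))
    (hstd : ∀ w (hw : w ∈ A.Voddss), (P w).scale (A.wComponent X.zTheta w (𝔇.toAdelicThetaDatum X).lastLabel) = 1)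
    (hne : X.Vss.Nonempty) {ρ : ℝ} (hρ : ρ ∈ Set.Ioo (0 : ℝ) 1) :
    (𝔇.toAdelicThetaDatum X).Cor741At ρ :=
  (𝔇.toAdelicThetaDatum X).cor741At_of_standardPointNorms
    (𝔇.standardPointNorms_of_prototype X P hl hq0 hxi a ha hy hstd) hne hρ

/-- **The size of the distinguished element `Ξ^α_{0,z_Θ} ∈ Θ̃^{B_{L′}}_Joshi` in closed product form** (proof of Thm. 7.3.1 p.56 l.38–45:
`|Ξ^α_{0,z_Θ}|_{B_{L′},ρ} = ∏_{w ∈ V^{odd,ss}} ∏_{j=1}^{ℓ⋇} |q_w|^{(1/2ℓ)(j²/ℓ⋇²)}` at every `ρ ∈ (0,1]`), ON THE ACTUAL LOCUS, from the prototypes modulo (STD)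
(E-t12's `adelicSize_std_of_standardPointNorms` p429865 + E-t11's `Xi_std_toAdelicThetaDatum`). [claim: Joshi2024ATS3, status: disputed] -/
theorem adelicSize_distinguishedLift_of_prototype (X : 𝔇.BLData)
    (P : ∀ w, PrototypeDatum (F w) (B₀ w) (E₀ w) (A.Y w) (K w) (G w))
    (hl : ∀ w ∈ A.Voddss, (P w).lstar = A.lstar)
    (hq0 : ∀ w ∈ A.Voddss, (P w).abs0 (P w).q = X.qAbs w)
    (hxi : ∀ w ∈ A.Voddss, ∀ j : Fin A.lstar,
      (𝔇.lift w).absK (A.wComponent X.zTheta w j) ((𝔇.lift w).xi (A.wComponent X.zTheta w j)) =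
        (P w).absK (A.wComponent X.zTheta w j) ((P w).emb (A.wComponent X.zTheta w j) (P w).xi))
    (a : ∀ w, F w) (ha : ∀ w ∈ A.Voddss, a w ∈ (P w).AnsatzParam)
    (hy : ∀ w (hw : w ∈ A.Voddss) (j : Fin A.lstar),
      A.wComponent X.zTheta w j = (P w).ansatzPt (a w) (Fin.cast (hl w hw).symm j))
    (hstd : ∀ w (hw : w ∈ A.Voddss), (P w).scale (A.wComponent X.zTheta w (𝔇.toAdelicThetaDatum X).lastLabel) = 1)
    {ρ : ℝ} (hρ : ρ ∈ Set.Ioc (0 : ℝ) 1) :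
    (𝔇.toAdelicThetaDatum X).adelicSize ρ (𝔇.distinguishedLift X.zTheta X.α) =
      ∏ w ∈ X.Vss, ∏ j : Fin A.lstar, X.qAbs w ^ (𝔇.toAdelicThetaDatum X).stdExponent j := by
  rw [← 𝔇.Xi_std_toAdelicThetaDatum X]
  exact (𝔇.toAdelicThetaDatum X).adelicSize_std_of_standardPointNorms
    (𝔇.standardPointNorms_of_prototype X P hl hq0 hxi a ha hy hstd) hρ

end Prototype

end AdelicLiftDatum

end Summit.ABC.IUTFork.Joshi.ATS3

end
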